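import Summits.QuantumFields.BalabanUV.T4Continuum.Support.AveragingDeficitSideDeriv

/-!
# AveragingDeficitPlaqDeriv (T⁴ programme, node NE3, row NE3-R2) — the derivative of the COARSE PLAQUETTE VARIABLE
# `V̄(∂P) = V̄(c₁)V̄(c₂)V̄(c₃)⁻¹V̄(c₄)⁻¹` (B7 (44)) along `V e^{sψ}`: the product rule with the four left-trivialised side
# derivatives, `d/ds|₀ V̄_s(∂P) = Ω_P · V̄(∂P)`, `Ω_P = δ₁ + Ad_{B₁}δ₂ − Ad_{B₁B₂B₃⁻¹}δ₃ − Ad_{B₁B₂B₃⁻¹B₄⁻¹}δ₄`; `Ω_P` is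
# SKEW (unitary path); the coarse Wilson-weight derivative `t_P = −Re tr(Ω_P V̄(∂P)) = −Re tr(Ω_P (V̄(∂P) − 1))`
# (layer (DL), part 2)

HONEST FRAMING, CITATION HEADER, PLACEMENT: as in `AveragingDeficitSideDeriv` / `AveragingDeficitDerivCore` (this unit
`b2b-balaban-t4-ne3r2-p1`, BINDER-OWNERS row NE3-R2; β = `DeficitDerivWall` NOT proved here; [folklore] matrix calculus on
the tree's transcriptions of (42)/(44); `[cite:]` tags are CONTEXT; NE3 COND-free; finite-T⁴ rung (B)+1, not Clay).
WHAT IS PROVED.  §1 `hasDerivAt_units_inv` (left-trivialised derivative of `s ↦ u(s)⁻¹` is `−Ad_{u⁻¹}δ`), `plaqDeriv`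
(`Ω` from four side derivatives), **`hasDerivAt_cplaq_of_sides`** (the product rule for (44)).  §2 `vary_isUnitaryCfg`, `plaqOmega` (`Ω_P` for `W_s = \overline{V e^{sψ}}`), **`hasDerivAt_val_chol_vary`**,
**`plaqOmega_mem_skewAdjoint`**, **`hasDerivAt_wt_chol_vary`** (`t_P = −Re tr(Ω_P V̄(∂P))`) and
**`deriv_wt_chol_eq`** (`t_P = −Re tr(Ω_P (V̄(∂P) − 1))` for any derivative `t_P`, by uniqueness and `Re tr Ω_P = 0`),
`norm_plaqOmega_le` (`‖Ω_P‖ ≤ Σ_i ‖δ_i‖` on `U(N)` data).  Record: HOME `t4/T4-EST-NE3-R2.md`.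
-/

set_option autoImplicit false

open scoped BigOperators Matrix Matrix.Norms.L2Operator Topology
open NormedSpace Finset Filter

namespace Summit.QuantumFields.BalabanUV.T4Continuum.AveragingDeficitPlaqDeriv

open Literature.MathematicalPhysics.QuantumFieldTheory.Balaban1983to89
open B7Prop1Explicit B7Prop2Explicit MatrixLog UnitaryModel
open T4AveragingDeficitWall hiding Site Plane Plaq Bond
open T4AveragingDeficitNonAbelian (Ad_mul Ad_sub)
open AveragingDeficitTransport AveragingDeficitLocality AveragingDeficitNearIdentity AveragingDeficitSideDeriv

noncomputable section

variable {d : ℕ} {n : Type*} [Fintype n] [DecidableEq n]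

local notation "𝕄" => Matrix n n ℂ
local notation "Site" => B7Prop1Explicit.Site
local notation "Plane" => T4AveragingDeficitWall.Plane
local notation "Plaq" => T4AveragingDeficitWall.Plaq

/-! ## §1 The product rule for the coarse plaquette variable (44) -/

/-- **Left-trivialised derivative of an inverse**: if `d/ds|₀ u_s = δ·u₀` then `d/ds|₀ u_s⁻¹ = (−Ad_{u₀⁻¹}δ)·u₀⁻¹`.
[folklore] -/
theorem hasDerivAt_units_inv {u : ℝ → 𝕄ˣ} {δ : 𝕄} (h : HasDerivAt (fun s => ((u s : 𝕄ˣ) : 𝕄)) (δ * (u 0 : 𝕄)) 0) :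
    HasDerivAt (fun s => (((u s)⁻¹ : 𝕄ˣ) : 𝕄)) (-Ad (u 0)⁻¹ δ * (((u 0)⁻¹ : 𝕄ˣ) : 𝕄)) 0 := by
  have h1 := (hasFDerivAt_ringInverse (𝕜 := ℝ) (u 0)).comp_hasDerivAt (0 : ℝ) h
  have e1 : (fun s => (((u s)⁻¹ : 𝕄ˣ) : 𝕄)) = Ring.inverse ∘ fun s => ((u s : 𝕄ˣ) : 𝕄) := by
    funext s; simp only [Function.comp_apply, Ring.inverse_unit]
  rw [e1]
  refine h1.congr_deriv ?_
  simp only [_root_.neg_apply, ContinuousLinearMap.mulLeftRight_apply, Ad, inv_inv, neg_mul, mul_assoc]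

/-- `Ω` of a coarse plaquette from the four left-trivialised side derivatives `δ₁,…,δ₄` and the side variables
`B₁,…,B₄` (word `+ + − −`): `δ₁ + Ad_{B₁}δ₂ − Ad_{B₁B₂B₃⁻¹}δ₃ − Ad_{B₁B₂B₃⁻¹B₄⁻¹}δ₄`. [folklore] -/
def plaqDeriv (B₁ B₂ B₃ B₄ : 𝕄ˣ) (δ₁ δ₂ δ₃ δ₄ : 𝕄) : 𝕄 :=
  δ₁ + Ad B₁ δ₂ - Ad (B₁ * B₂ * B₃⁻¹) δ₃ - Ad (B₁ * B₂ * B₃⁻¹ * B₄⁻¹) δ₄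

/-- **THE PRODUCT RULE FOR (44)**: if the four sides of the coarse plaquette with fine corner `z` differentiate as
`d/ds|₀ W_s(c_i) = δ_i·W₀(c_i)`, then `d/ds|₀ W_s(∂P) = Ω·W₀(∂P)` with `Ω = plaqDeriv`. [cite: Balaban1985Averaging, (44) p.24] -/
theorem hasDerivAt_cplaq_of_sides (L : ℕ) (W : ℝ → Site d → Fin d → 𝕄ˣ) (z : Site d) (μ ν : Fin d)
    {δ₁ δ₂ δ₃ δ₄ : 𝕄}
    (h₁ : HasDerivAt (fun s => ((W s z μ : 𝕄ˣ) : 𝕄)) (δ₁ * (W 0 z μ : 𝕄)) 0)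
    (h₂ : HasDerivAt (fun s => ((W s (z + (L : ℤ) • e μ) ν : 𝕄ˣ) : 𝕄)) (δ₂ * (W 0 (z + (L : ℤ) • e μ) ν : 𝕄)) 0)
    (h₃ : HasDerivAt (fun s => ((W s (z + (L : ℤ) • e ν) μ : 𝕄ˣ) : 𝕄)) (δ₃ * (W 0 (z + (L : ℤ) • e ν) μ : 𝕄)) 0)
    (h₄ : HasDerivAt (fun s => ((W s z ν : 𝕄ˣ) : 𝕄)) (δ₄ * (W 0 z ν : 𝕄)) 0) :
    HasDerivAt (fun s => ((cplaq L (W s) z μ ν : 𝕄ˣ) : 𝕄))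
      (plaqDeriv (W 0 z μ) (W 0 (z + (L : ℤ) • e μ) ν) (W 0 (z + (L : ℤ) • e ν) μ) (W 0 z ν) δ₁ δ₂ δ₃ δ₄
        * ((cplaq L (W 0) z μ ν : 𝕄ˣ) : 𝕄)) 0 := by
  have h₃' := hasDerivAt_units_inv (u := fun s => W s (z + (L : ℤ) • e ν) μ) h₃
  have h₄' := hasDerivAt_units_inv (u := fun s => W s z ν) h₄
  have H := ((h₁.mul h₂).mul h₃').mul h₄'
  have e1 : (fun s => ((cplaq L (W s) z μ ν : 𝕄ˣ) : 𝕄))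
      = fun s => ((W s z μ : 𝕄ˣ) : 𝕄) * ((W s (z + (L : ℤ) • e μ) ν : 𝕄ˣ) : 𝕄)
          * (((W s (z + (L : ℤ) • e ν) μ)⁻¹ : 𝕄ˣ) : 𝕄) * (((W s z ν)⁻¹ : 𝕄ˣ) : 𝕄) := by
    funext s; simp only [cplaq, Units.val_mul]
  rw [e1]
  refine H.congr_deriv ?_
  simp only [plaqDeriv, cplaq, Ad, Pi.mul_apply, Units.val_mul, mul_inv_rev, inv_inv, add_mul, sub_mul, neg_mul,
    mul_neg, mul_assoc, Units.inv_mul_cancel_left, Units.mul_inv_cancel_left, Units.mul_inv, mul_one]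
  abel

/-! ## §2 The coarse plaquette variable of the averaged configuration along `V e^{sψ}` -/

/-- `V e^{sψ}` is `U(N)`-valued for unitary `V` and skew `ψ`. [folklore] -/
theorem vary_isUnitaryCfg {V : Site d → Fin d → 𝕄ˣ} (hV : IsUnitaryCfg V) {ψ : Site d → Fin d → 𝕄}
    (hψ : IsSkewDir ψ) (s : ℝ) : IsUnitaryCfg (vary V ψ s) := by
  letI : NormedAlgebra ℚ 𝕄 := NormedAlgebra.restrictScalars ℚ ℝ 𝕄
  intro x κ
  unfold vary
  refine mul_mem (hV x κ) ?_
  rw [mem_unitaryUnits, val_expUnit]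
  refine NormedSpace.exp_mem_unitary_of_mem_skewAdjoint ?_
  have h := hψ x κ
  rw [skewAdjoint.mem_iff] at h ⊢
  rw [star_smul, h, smul_neg, Complex.star_def, Complex.conj_ofReal]

/-- **`Ω_P` for the perturbation `V e^{sψ}`**: `plaqDeriv` of the four averaged sides with the side derivatives of
`AveragingDeficitSideDeriv`. [cite: Balaban1985Averaging, (42) p.23, (44) p.24] -/
def plaqOmega (L : ℕ) (V : Site d → Fin d → 𝕄ˣ) (ψ : Site d → Fin d → 𝕄) (z : Site d) (μ ν : Fin d) : 𝕄 :=
  plaqDeriv (bavg L V z μ) (bavg L V (z + (L : ℤ) • e μ) ν) (bavg L V (z + (L : ℤ) • e ν) μ) (bavg L V z ν)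
    (sideDeriv L V ψ z μ) (sideDeriv L V ψ (z + (L : ℤ) • e μ) ν) (sideDeriv L V ψ (z + (L : ℤ) • e ν) μ)
    (sideDeriv L V ψ z ν)

/-- **`d/ds|₀ \overline{V e^{sψ}}(∂P) = Ω_P · V̄(∂P)`** (inside the ball). [cite: Balaban1985Averaging, (42) p.23, (44) p.24] -/
theorem hasDerivAt_val_chol_vary (L : ℕ) (V : Site d → Fin d → 𝕄ˣ) (ψ : Site d → Fin d → 𝕄) (z : Site d)
    (μ ν : Fin d)
    (hW : ∀ (q : Site d) (κ : Fin d) (r : Fin d → Fin L), ‖((Wcx L V q κ (boxVec L r) : 𝕄ˣ) : 𝕄) - 1‖ < 1) :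
    HasDerivAt (fun s : ℝ => ((cplaq L (bavg L (vary V ψ s)) z μ ν : 𝕄ˣ) : 𝕄))
      (plaqOmega L V ψ z μ ν * ((cplaq L (bavg L V) z μ ν : 𝕄ˣ) : 𝕄)) 0 := by
  have h := hasDerivAt_cplaq_of_sides L (fun s => bavg L (vary V ψ s)) z μ ν
    (δ₁ := sideDeriv L V ψ z μ) (δ₂ := sideDeriv L V ψ (z + (L : ℤ) • e μ) ν)
    (δ₃ := sideDeriv L V ψ (z + (L : ℤ) • e ν) μ) (δ₄ := sideDeriv L V ψ z ν)
    (by simpa only [vary_zero] using hasDerivAt_val_bavg_vary L V ψ z μ (hW z μ))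
    (by simpa only [vary_zero] using hasDerivAt_val_bavg_vary L V ψ _ ν (hW _ ν))
    (by simpa only [vary_zero] using hasDerivAt_val_bavg_vary L V ψ _ μ (hW _ μ))
    (by simpa only [vary_zero] using hasDerivAt_val_bavg_vary L V ψ z ν (hW z ν))
  simpa only [vary_zero, plaqOmega] using h

/-- **`Ω_P` IS SKEW-ADJOINT** on `U(N)` data with `𝔲(N)` directions (all loop variables of the four sides within `1/4`
of `1`): it is the log-derivative of the unitary path `s ↦ \overline{V e^{sψ}}(∂P)`. [folklore] -/
theorem plaqOmega_mem_skewAdjoint [Nonempty n] (L : ℕ) {V : Site d → Fin d → 𝕄ˣ} (hV : IsUnitaryCfg V)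
    {ψ : Site d → Fin d → 𝕄} (hψ : IsSkewDir ψ) (z : Site d) (μ ν : Fin d)
    (hW : ∀ (q : Site d) (κ : Fin d) (r : Fin d → Fin L), ‖((Wcx L V q κ (boxVec L r) : 𝕄ˣ) : 𝕄) - 1‖ < 1 / 4) :
    plaqOmega L V ψ z μ ν ∈ skewAdjoint 𝕄 := by
  letI : CStarAlgebra 𝕄 := {}
  have hW1 : ∀ (q : Site d) (κ : Fin d) (r : Fin d → Fin L), ‖((Wcx L V q κ (boxVec L r) : 𝕄ˣ) : 𝕄) - 1‖ < 1 :=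
    fun q κ r => (hW q κ r).trans (by norm_num)
  have hd := hasDerivAt_val_chol_vary L V ψ z μ ν hW1
  -- unitarity of the path near `0`
  have hq : ∀ (q : Site d) (κ : Fin d), ∀ᶠ s in 𝓝 (0 : ℝ), ∀ r : Fin d → Fin L,
      ‖((Wcx L (vary V ψ s) q κ (boxVec L r) : 𝕄ˣ) : 𝕄) - 1‖ ≤ 1 / 4 := fun q κ =>
    Filter.eventually_all.mpr fun r =>
      (eventually_norm_Wcx_vary_sub_one_lt L V ψ q κ (boxVec L r) (hW q κ r)).mono fun s hs => hs.le
  have hu : ∀ᶠ s in 𝓝 (0 : ℝ), ((cplaq L (bavg L (vary V ψ s)) z μ ν : 𝕄ˣ) : 𝕄) ∈ unitary 𝕄 := by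
    refine ((hq z μ).and ((hq (z + (L : ℤ) • e μ) ν).and ((hq (z + (L : ℤ) • e ν) μ).and (hq z ν)))).mono
      fun s hs => ?_
    obtain ⟨h0, h1, h2, h3⟩ := hs
    have hVs := vary_isUnitaryCfg hV hψ s
    rw [← mem_unitaryUnits]
    unfold cplaq
    exact mul_mem (mul_mem (mul_mem (bavg_mem_unitaryUnits hVs L _ _ h0) (bavg_mem_unitaryUnits hVs L _ _ h1))
      (inv_mem (bavg_mem_unitaryUnits hVs L _ _ h2))) (inv_mem (bavg_mem_unitaryUnits hVs L _ _ h3))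
  have hskew := mem_skewAdjoint_of_unitary_path hd hu
  -- `Ω C C⋆ = Ω`
  have hC : ((cplaq L (bavg L (vary V ψ 0)) z μ ν : 𝕄ˣ) : 𝕄) ∈ unitary 𝕄 := hu.self_of_nhds
  simp only [vary_zero] at hC hskew
  rwa [mul_assoc, Unitary.mul_star_self_of_mem hC, mul_one] at hskew

/-- **THE COARSE WILSON-WEIGHT DERIVATIVE**: `d/ds|₀ (1 − Re tr \overline{V e^{sψ}}(∂P)) = −Re tr(Ω_P · V̄(∂P))`.
[cite: Balaban1985Variational, (5) p.278] -/
theorem hasDerivAt_wt_chol_vary (L : ℕ) (V : Site d → Fin d → 𝕄ˣ) (ψ : Site d → Fin d → 𝕄) (y : Site d)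
    (π : Plane d)
    (hW : ∀ (q : Site d) (κ : Fin d) (r : Fin d → Fin L), ‖((Wcx L V q κ (boxVec L r) : 𝕄ˣ) : 𝕄) - 1‖ < 1) :
    HasDerivAt (fun s : ℝ => wt (chol L (vary V ψ s) (y, π)))
      (-nReTr (plaqOmega L V ψ ((L : ℤ) • y) π.1.1 π.1.2 * ((chol L V (y, π) : 𝕄ˣ) : 𝕄))) 0 := by
  have h := ((nReTrL (n := n)).hasFDerivAt.comp_hasDerivAt (0 : ℝ)
    (hasDerivAt_val_chol_vary L V ψ ((L : ℤ) • y) π.1.1 π.1.2 hW)).const_sub 1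
  simpa [wt, chol, Function.comp_def] using h

/-- **`t_P = −Re tr(Ω_P (V̄(∂P) − 1))`** for ANY derivative `t_P` of the coarse weight at `0` (uniqueness of derivatives
and `Re tr Ω_P = 0`). [folklore] -/
theorem deriv_wt_chol_eq [Nonempty n] (L : ℕ) {V : Site d → Fin d → 𝕄ˣ} (hV : IsUnitaryCfg V)
    {ψ : Site d → Fin d → 𝕄} (hψ : IsSkewDir ψ) (y : Site d) (π : Plane d)
    (hW : ∀ (q : Site d) (κ : Fin d) (r : Fin d → Fin L), ‖((Wcx L V q κ (boxVec L r) : 𝕄ˣ) : 𝕄) - 1‖ < 1 / 4)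
    {t : ℝ} (ht : HasDerivAt (fun s : ℝ => wt (chol L (vary V ψ s) (y, π))) t 0) :
    t = -nReTr (plaqOmega L V ψ ((L : ℤ) • y) π.1.1 π.1.2 * (((chol L V (y, π) : 𝕄ˣ) : 𝕄) - 1)) := by
  have hW1 : ∀ (q : Site d) (κ : Fin d) (r : Fin d → Fin L), ‖((Wcx L V q κ (boxVec L r) : 𝕄ˣ) : 𝕄) - 1‖ < 1 :=
    fun q κ r => (hW q κ r).trans (by norm_num)
  have h := ht.unique (hasDerivAt_wt_chol_vary L V ψ y π hW1)
  rw [h, mul_sub, mul_one]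
  have hlin : nReTr (plaqOmega L V ψ ((L : ℤ) • y) π.1.1 π.1.2 * ((chol L V (y, π) : 𝕄ˣ) : 𝕄)
      - plaqOmega L V ψ ((L : ℤ) • y) π.1.1 π.1.2)
      = nReTr (plaqOmega L V ψ ((L : ℤ) • y) π.1.1 π.1.2 * ((chol L V (y, π) : 𝕄ˣ) : 𝕄))
        - nReTr (plaqOmega L V ψ ((L : ℤ) • y) π.1.1 π.1.2) := by
    rw [← nReTrL_apply, ← nReTrL_apply, ← nReTrL_apply, map_sub]
  rw [hlin, nReTr_eq_zero_of_mem_skewAdjoint (plaqOmega_mem_skewAdjoint L hV hψ _ _ _ hW), sub_zero]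

/-- `‖Ω_P‖ ≤ Σ_i ‖δ_i‖` on `U(N)` data (the dressings are unitary). [folklore] -/
theorem norm_plaqOmega_le {V : Site d → Fin d → 𝕄ˣ} (hV : IsUnitaryCfg V) (L : ℕ) (ψ : Site d → Fin d → 𝕄)
    (z : Site d) (μ ν : Fin d)
    (hW : ∀ (q : Site d) (κ : Fin d) (r : Fin d → Fin L), ‖((Wcx L V q κ (boxVec L r) : 𝕄ˣ) : 𝕄) - 1‖ ≤ 1 / 4) :
    ‖plaqOmega L V ψ z μ ν‖ ≤ ‖sideDeriv L V ψ z μ‖ + ‖sideDeriv L V ψ (z + (L : ℤ) • e μ) ν‖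
      + ‖sideDeriv L V ψ (z + (L : ℤ) • e ν) μ‖ + ‖sideDeriv L V ψ z ν‖ := by
  letI : CStarAlgebra 𝕄 := {}
  have hb : ∀ (q : Site d) (κ : Fin d), bavg L V q κ ∈ unitaryUnits 𝕄 := fun q κ =>
    bavg_mem_unitaryUnits hV L q κ (hW q κ)
  unfold plaqOmega plaqDeriv
  have hu1 := hb z μ
  have hu2 : bavg L V z μ * bavg L V (z + (L : ℤ) • e μ) ν * (bavg L V (z + (L : ℤ) • e ν) μ)⁻¹ ∈ unitaryUnits 𝕄 :=
    mul_mem (mul_mem (hb _ _) (hb _ _)) (inv_mem (hb _ _))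
  have hu3 : bavg L V z μ * bavg L V (z + (L : ℤ) • e μ) ν * (bavg L V (z + (L : ℤ) • e ν) μ)⁻¹ * (bavg L V z ν)⁻¹
      ∈ unitaryUnits 𝕄 := mul_mem hu2 (inv_mem (hb _ _))
  calc _ ≤ ‖sideDeriv L V ψ z μ‖ + ‖Ad (bavg L V z μ) (sideDeriv L V ψ (z + (L : ℤ) • e μ) ν)‖
        + ‖Ad (bavg L V z μ * bavg L V (z + (L : ℤ) • e μ) ν * (bavg L V (z + (L : ℤ) • e ν) μ)⁻¹)
            (sideDeriv L V ψ (z + (L : ℤ) • e ν) μ)‖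
        + ‖Ad (bavg L V z μ * bavg L V (z + (L : ℤ) • e μ) ν * (bavg L V (z + (L : ℤ) • e ν) μ)⁻¹ * (bavg L V z ν)⁻¹)
            (sideDeriv L V ψ z ν)‖ := by
        refine (norm_sub_le _ _).trans (add_le_add ((norm_sub_le _ _).trans (add_le_add (norm_add_le _ _) le_rfl))
          le_rfl)
    _ = _ := by rw [norm_Ad_of_unitary hu1, norm_Ad_of_unitary hu2, norm_Ad_of_unitary hu3]

end

end Summit.QuantumFields.BalabanUV.T4Continuum.AveragingDeficitPlaqDeriv
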